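import Summits.AtomisticToContinuum.Crystallization.Theorems.ChartedZeroExcessLayeredLatticeLiouvilleZZZYREC
import Summits.AtomisticToContinuum.Crystallization.Theorems.ChartedPlanarOrderStraddleSummable

/-!
# ZZZYRG — the HBAND leaf re-typed: HEIGHT OSCILLATION RIGIDITY + a two-dimensional cover door, and its dichotomy split
(decomp-a2c lens-2 «special vs generic», gen 102; binder `ChartedPlanarOrder.ChartedZeroExcessLayered`, line (D))

TARGET OF RECORD beneath the binder: `UniformEquilStabilityAtIn s Λ κ₀ c₀ W` through ZZZYREC's door
`uniformEquilStabilityAtIn_of_atlasW_hollow_window`, whose cover clause `hLo i ≤ hLoB ∧ hHiB ≤ hHi i` forces EVERY cell's height box to contain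
the whole H-band `[hLoB, hHiB]` (the clean band), so the census's narrow `ρ_h`-cells (Δh ≤ 0.03) are unusable: residual leaf (L1) «HBAND with width».

FINDING (FREE MODULUS).  (L1) typed PER CELL — «a word in the P-box of cell `i` with heights in the clean band has its heights in cell `i`'s
narrow band» — is false modulo a homogeneous inhabitant: the uniform gap of a homogeneous stacked equilibrium word (equivalently the transmitted
normal stress) is a FREE MODULUS ranging over the clean band at fixed scale `a`.  What is rigid is the OSCILLATION of the heights WITHIN one word.
Hence the leaf is re-typed as

* (L1′) `HOscPIn s Λ c₀ ℓ₀ δ hLoB hHiB ω W` — every admissible banded-hollow word at a scale `a ∈ W` has ALL its step heights within `ω·a` of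
  each other (location free), and
* the door is re-proved with a TWO-DIMENSIONAL cover: cells are chosen by `(a, u)` where `[u, u + ω]` is the word's own height interval —
  `∀ a ∈ [amin, amax], ∀ u, hLoB ≤ u → u + ω ≤ hHiB → ∃ i, aLo i ≤ a ≤ aHi i ∧ δ ≤ τ i ∧ hLo i ≤ u ∧ u + ω ≤ hHi i`
  (★ `uniformEquilStabilityAtIn_of_atlasW_hollow_window₂`; the door of record is the case `ω = hHiB − hLoB`, `cover₂_of_cover`).

DICHOTOMY SPLIT of (L1′) (special = the stress-balanced, own-gap-dominated locus; generic = everything else is uninhabited):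
`HOscPIn ω ⟸ WordStressBalancePIn (P1) ∧ OwnGapDominancePIn lam ε η (P2) ∧ [η / (lam − ε) ≤ ω·a on W]` (★ `hOscPIn_of_dominance`), where

* (P1) every such word transmits the SAME normal stress across every gap — PROVED here from the tree's D1 `NashBalance Λ`
  (`…StraddleSummable.nashBalance_holds`, PS column of lens-3) : `wordStressBalancePIn_of_nashBalance`, `wordStressBalancePIn_holds`;
* (P2) along the word's own height values the normal gap-stress map is `lam`-strongly monotone in the own gap, `ε`-Lipschitz (sup norm) in the
  other gaps and `η`-insensitive to the registry context (letters / slips) under index shift — INSTRUMENTABLE (census LAT13-type columns: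
  `lam` = nearest-layer normal stiffness, `ε` = span ≥ 2 couplings, `η` = letter flip + slip effect on the transmitted normal force), UNDECIDED;
* the glue is the abstract one-profile contraction `osc_le_of_dominates` (pure real analysis, PROVED): balance + dominance ⇒
  `osc ≤ η / (lam − ε)`.

WHY STRICTLY WEAKER.  (L1′) asserts nothing about WHERE a word's heights sit (the part of (L1) that is false); (P1) is a theorem; (P2) is a
finite list of inequalities on the inhabited locus only (profiles valued in the word's own heights), not a stability certificate, and it does not
imply the target without the cell certificates of the door.  WHY NOVEL.  No tree or pub file consumes the PS column (D1) on line (D); the doors of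
record quantify cells over the scale only; `HProfileRigidity` (r1870 (B)) was named but never typed.

Companion file ZZZYRGL (§3, separable): height LOCATION about the stress-free curve and the localised door — for the STRESS-RESTRICTED
class of the pending door edit (r1816/r1819) only.

0 sorry · no instances / notation / options · imports = tree ZZZYREC + tree StraddleSummable. [g102]
-/

noncomputable section

namespace Summit.AtomisticToContinuum.Crystallization.Theorems.ChartedZeroExcessLayeredLatticeLiouville

open scoped BigOperators RealInnerProductSpace
open Summit.AtomisticToContinuum.Crystallization.Theorems.ChartedPlanarOrderRigidityDoor (E3 IsClean IsNash)
open Summit.AtomisticToContinuum.Crystallization.Theorems.ChartedPlanarOrderDensityDichotomy (μS IsSep)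
open Summit.AtomisticToContinuum.Crystallization.Theorems.ChartedPlanarOrderDoorLayered (Layered)
open Summit.AtomisticToContinuum.Crystallization.Theorems.ChartedPlanarOrderProfileSlavingLJ (gapStress IsStacked NashBalance)
open Summit.AtomisticToContinuum.Crystallization.Theorems.ChartedPlanarOrderStraddleSummable (nashBalance_holds)
open Literature.MathematicalPhysics.StatisticalMechanics (triangularVec₁ triangularVec₂)

variable {ι : Type*}

/-! ## §0 The abstract one-profile contraction (pure real analysis) -/

/-- a stress-type map `Φ m` (stress across gap `m` as a function of the gap profile) is BALANCED along the profile `z`: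
it takes the same value across every gap. [g102] -/
def BalancedAt (Φ : ℤ → (ℤ → ℝ) → ℝ) (z : ℤ → ℝ) : Prop :=
  ∃ σ : ℝ, ∀ m : ℤ, Φ m z = σ

/-- OWN-GAP DOMINANCE of `Φ` along `z` with constants `(lam, ε, η)`, tested only on profiles taking values among the values of `z`:
(M) `Φ m` is `lam`-strongly monotone in the own gap `y m`; (C) `Φ m` is `ε`-Lipschitz in the other gaps for the sup distance;
(R) context insensitivity under index shift: evaluating gap `m`'s map on the profile shifted from `m'` differs from gap `m'`'s map by `≤ η`. [g102] -/
def DominatesAt (Φ : ℤ → (ℤ → ℝ) → ℝ) (z : ℤ → ℝ) (lam ε η : ℝ) : Prop :=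
  (∀ (m : ℤ) (y : ℤ → ℝ), (∀ k, ∃ j, y k = z j) → ∀ t : ℝ, (∃ j, t = z j) →
      lam * |y m - t| ≤ |Φ m y - Φ m (Function.update y m t)|) ∧
  (∀ (m : ℤ) (y y' : ℤ → ℝ), (∀ k, ∃ j, y k = z j) → (∀ k, ∃ j, y' k = z j) → y m = y' m →
      |Φ m y - Φ m y'| ≤ ε * ⨆ k : ℤ, |y k - y' k|) ∧
  (∀ (m m' : ℤ) (y : ℤ → ℝ), (∀ k, ∃ j, y k = z j) → |Φ m (fun k => y (k + (m' - m))) - Φ m' y| ≤ η)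

/-- ★ THE ONE-PROFILE CONTRACTION: a bounded profile along which a dominated stress map is balanced has oscillation `≤ η / (lam − ε)`.
Proof: with `O` the oscillation, comparing gap `m` with the profile shifted from `m'` gives `lam·|z m − z m'| ≤ η + ε·O`, hence
`(lam − ε)·O ≤ η`. [g102] -/
theorem osc_le_of_dominates {Φ : ℤ → (ℤ → ℝ) → ℝ} {z : ℤ → ℝ} {lo hi lam ε η : ℝ}
    (hbd : ∀ k : ℤ, lo ≤ z k ∧ z k ≤ hi) (hε : 0 ≤ ε) (hlam : ε < lam)
    (hD : DominatesAt Φ z lam ε η) (hB : BalancedAt Φ z) : ∀ m m' : ℤ, |z m - z m'| ≤ η / (lam - ε) := by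
  obtain ⟨hM, hC, hR⟩ := hD
  obtain ⟨σ, hσ⟩ := hB
  have hlam0 : 0 < lam := hε.trans_lt hlam
  have hObdd : BddAbove (Set.range fun p : ℤ × ℤ => |z p.1 - z p.2|) := by
    refine ⟨hi - lo, ?_⟩
    rintro _ ⟨p, rfl⟩
    rw [abs_sub_le_iff]
    constructor <;> linarith [hbd p.1, hbd p.2]
  have hle : ∀ m m' : ℤ, |z m - z m'| ≤ ⨆ p : ℤ × ℤ, |z p.1 - z p.2| := fun m m' => le_ciSup hObdd (m, m')
  set O := ⨆ p : ℤ × ℤ, |z p.1 - z p.2| with hO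
  have hO0 : 0 ≤ O := (abs_nonneg _).trans (hle 0 0)
  have hown : ∀ k : ℤ, ∃ j, z k = z j := fun k => ⟨k, rfl⟩
  have hkey : ∀ m m' : ℤ, lam * |z m - z m'| ≤ η + ε * O := by
    intro m m'
    have hmm : m + (m' - m) = m' := by abel
    have hy'own : ∀ k : ℤ, ∃ j, (fun k => z (k + (m' - m))) k = z j := fun k => ⟨k + (m' - m), rfl⟩
    have huown : ∀ k : ℤ, ∃ j, Function.update z m (z m') k = z j := by
      intro k
      by_cases hk : k = m
      · exact ⟨m', by rw [hk, Function.update_self]⟩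
      · exact ⟨k, by rw [Function.update_of_ne hk]⟩
    have hum : Function.update z m (z m') m = (fun k => z (k + (m' - m))) m := by
      rw [Function.update_self]
      show z m' = z (m + (m' - m))
      rw [hmm]
    have h1 : |Φ m z - Φ m (fun k => z (k + (m' - m)))| ≤ η := by
      rw [hσ m, ← hσ m', abs_sub_comm]
      exact hR m m' z hown
    have h2 : lam * |z m - z m'| ≤ |Φ m z - Φ m (Function.update z m (z m'))| := hM m z hown (z m') ⟨m', rfl⟩
    have h3 : |Φ m (Function.update z m (z m')) - Φ m (fun k => z (k + (m' - m)))| ≤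
        ε * ⨆ k : ℤ, |Function.update z m (z m') k - (fun k => z (k + (m' - m))) k| :=
      hC m _ _ huown hy'own hum
    have h4 : (⨆ k : ℤ, |Function.update z m (z m') k - (fun k => z (k + (m' - m))) k|) ≤ O := by
      refine ciSup_le fun k => ?_
      by_cases hk : k = m
      · rw [hk, hum, sub_self, abs_zero]; exact hO0
      · rw [Function.update_of_ne hk]; exact hle k (k + (m' - m))
    calc lam * |z m - z m'| ≤ |Φ m z - Φ m (Function.update z m (z m'))| := h2
      _ ≤ |Φ m z - Φ m (fun k => z (k + (m' - m)))| +
            |Φ m (fun k => z (k + (m' - m))) - Φ m (Function.update z m (z m'))| := abs_sub_le _ _ _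
      _ ≤ η + ε * O := by
          refine add_le_add h1 ?_
          rw [abs_sub_comm]
          exact h3.trans (mul_le_mul_of_nonneg_left h4 hε)
  have h5 : O * lam ≤ η + ε * O := by
    have : O ≤ (η + ε * O) / lam := ciSup_le fun p => by rw [le_div_iff₀ hlam0, mul_comm]; exact hkey p.1 p.2
    rwa [le_div_iff₀ hlam0] at this
  have hOle : O ≤ η / (lam - ε) := by
    rw [le_div_iff₀ (sub_pos.2 hlam)]
    nlinarith [h5]
  intro m m'
  exact (hle m m').trans hOle

/-! ## §1 Height oscillation rigidity and the two-dimensional cover door -/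

/-- the normal component of the step from layer `k − 1` to layer `k` (the HEIGHT of gap `k`, increment convention of the PS column). [g102] -/
def stepNormal (n : E3) (w' : ℤ → E3) (k : ℤ) : ℝ := ⟪w' k - w' (k - 1), n⟫

/-- `n` is a unit normal of the chart plane along which every step of `w'` has height in the band `[hLoB·a, hHiB·a]`
(the data every banded registered labelling carries). [g102] -/
def IsBandNormal (hLoB hHiB a : ℝ) (L : E3 ≃L[ℝ] E3) (w' : ℤ → E3) (n : E3) : Prop :=
  ‖n‖ = 1 ∧ ⟪gen₁ L, n⟫ = 0 ∧ ⟪gen₂ L, n⟫ = 0 ∧ ∀ m : ℤ, hLoB * a ≤ ⟪w' (m + 1) - w' m, n⟫ ∧ ⟪w' (m + 1) - w' m, n⟫ ≤ hHiB * a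

/-- **(L1′) «HOscPIn s Λ c₀ ℓ₀ δ hLoB hHiB ω W» — HEIGHT OSCILLATION RIGIDITY** (CELL-ID · replaces (L1) «HBAND with width»): every admissible
banded-hollow word at a scale `a ∈ W` has all its step heights within `ω·a` of each other — WHERE in the band they sit is NOT asserted
(that location is a free modulus).  UNDECIDED; split below into (P1) ∧ (P2). [g102] -/
def HOscPIn (s Λ c₀ ℓ₀ δ hLoB hHiB ω : ℝ) (W : Set ℝ) : Prop :=
  ∀ a : ℝ, a ∈ W → 0 < a → ∀ (L : E3 ≃L[ℝ] E3) (w' : ℤ → E3), IsAdmissibleWord a s Λ c₀ ℓ₀ L w' →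
    IsRegisteredWordBH δ hLoB hHiB a L w' → ∀ n : E3, IsBandNormal hLoB hHiB a L w' n →
      ∀ m m' : ℤ, |stepNormal n w' m - stepNormal n w' m'| ≤ ω * a

/-- monotonicity of (L1′) in the width. [g102] -/
theorem HOscPIn.mono {s Λ c₀ ℓ₀ δ hLoB hHiB ω ω' : ℝ} {W : Set ℝ} (h : HOscPIn s Λ c₀ ℓ₀ δ hLoB hHiB ω W) (hω : ω ≤ ω') :
    HOscPIn s Λ c₀ ℓ₀ δ hLoB hHiB ω' W :=
  fun a haW ha L w' hA hreg n hn m m' => (h a haW ha L w' hA hreg n hn m m').trans (mul_le_mul_of_nonneg_right hω ha.le)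

/-- NARROWING: a banded-hollow registered word whose heights oscillate by `≤ ω·a` is registered in a band `[u, u + ω] ⊆ [hLoB, hHiB]` of
width `ω` (take `u·a` = the infimum of the heights, capped at `hHiB − ω`). [g102] -/
theorem isRegisteredWordBH_narrow {δ hLoB hHiB ω a : ℝ} {L : E3 ≃L[ℝ] E3} {w' : ℤ → E3} (ha : 0 < a) (hωB : hLoB + ω ≤ hHiB)
    (hreg : IsRegisteredWordBH δ hLoB hHiB a L w')
    (hosc : ∀ n : E3, IsBandNormal hLoB hHiB a L w' n → ∀ m m' : ℤ, |stepNormal n w' m - stepNormal n w' m'| ≤ ω * a) :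
    ∃ u : ℝ, hLoB ≤ u ∧ u + ω ≤ hHiB ∧ IsRegisteredWordBH δ u (u + ω) a L w' := by
  obtain ⟨ℓ, n, r, h, hℓ, hH, hn, hg₁, hg₂, hrh, hstep⟩ := hreg
  have hm : ∀ m : ℤ, ⟪w' (m + 1) - w' m, n⟫ = h m := fun m => by
    rw [hstep m]; exact inner_registeredStep hn hg₁ hg₂ (hrh m).2.1 _ _
  have hbn : IsBandNormal hLoB hHiB a L w' n :=
    ⟨hn, hg₁, hg₂, fun m => by rw [hm m]; exact ⟨(hrh m).2.2.1, (hrh m).2.2.2⟩⟩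
  have hosc' : ∀ m m' : ℤ, h m ≤ h m' + ω * a := by
    intro m m'
    have h1 := hosc n hbn (m + 1) (m' + 1)
    simp only [stepNormal, add_sub_cancel_right] at h1
    rw [hm m, hm m'] at h1
    linarith [(abs_le.1 h1).2]
  have hbdd : BddBelow (Set.range h) := ⟨hLoB * a, by rintro _ ⟨m, rfl⟩; exact (hrh m).2.2.1⟩
  have hUle : ∀ m, (⨅ m, h m) ≤ h m := fun m => ciInf_le hbdd m
  have hleU : hLoB * a ≤ ⨅ m, h m := le_ciInf fun m => (hrh m).2.2.1
  have hhU : ∀ m, h m ≤ (⨅ m, h m) + ω * a := fun m => by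
    have : h m - ω * a ≤ ⨅ m, h m := le_ciInf fun m' => by linarith [hosc' m m']
    linarith
  set U := ⨅ m, h m with hU
  have ha' : a ≠ 0 := ha.ne'
  refine ⟨min (U / a) (hHiB - ω), le_min (by rwa [le_div_iff₀ ha]) (by linarith),
    by linarith [min_le_right (U / a) (hHiB - ω)], ℓ, n, r, h, hℓ, hH, hn, hg₁, hg₂,
    fun m => ⟨(hrh m).1, (hrh m).2.1, ?_, ?_⟩, hstep⟩
  · calc min (U / a) (hHiB - ω) * a ≤ U / a * a := mul_le_mul_of_nonneg_right (min_le_left _ _) ha.le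
      _ = U := div_mul_cancel₀ U ha'
      _ ≤ h m := hUle m
  · rcases le_total (U / a) (hHiB - ω) with hc | hc
    · rw [min_eq_left hc]
      have : (U / a + ω) * a = U + ω * a := by field_simp
      rw [this]; exact hhU m
    · rw [min_eq_right hc]
      have : (hHiB - ω + ω) * a = hHiB * a := by ring
      rw [this]; exact (hrh m).2.2.2

/-- the door of record's cover (every cell's height box contains the whole band) is the two-dimensional cover for EVERY width `ω`. [g102] -/
theorem cover₂_of_cover {δ hLoB hHiB amin amax ω : ℝ} {aLo aHi τ hLo hHi : ι → ℝ}
    (hcover : ∀ a : ℝ, amin ≤ a → a ≤ amax → ∃ i, aLo i ≤ a ∧ a ≤ aHi i ∧ δ ≤ τ i ∧ hLo i ≤ hLoB ∧ hHiB ≤ hHi i) :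
    ∀ a : ℝ, amin ≤ a → a ≤ amax → ∀ u : ℝ, hLoB ≤ u → u + ω ≤ hHiB →
      ∃ i, aLo i ≤ a ∧ a ≤ aHi i ∧ δ ≤ τ i ∧ hLo i ≤ u ∧ u + ω ≤ hHi i := by
  intro a h1 h2 u hu1 hu2
  obtain ⟨i, haLo, haHi, hτ, hlo, hhi⟩ := hcover a h1 h2
  exact ⟨i, haLo, haHi, hτ, hlo.trans hu1, hu2.trans hhi⟩

/-- JSBOX-SOUND, two-dimensional: under (L1′) a cover of `[amin, amax] × {height intervals of width ω inside the band}` by cells covers the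
banded-hollow class on the window by hollow shape cells. [g102] -/
theorem atlasCoversPC_of_shapeCoverWH_window₂ {s Λ c₀ ℓ₀ δ hLoB hHiB amin amax ω : ℝ} {W : Set ℝ} {aLo aHi τ hLo hHi : ι → ℝ}
    (hW : W ⊆ Set.Icc amin amax) (hωB : hLoB + ω ≤ hHiB) (hHO : HOscPIn s Λ c₀ ℓ₀ δ hLoB hHiB ω W)
    (hcover : ∀ a : ℝ, amin ≤ a → a ≤ amax → ∀ u : ℝ, hLoB ≤ u → u + ω ≤ hHiB →
      ∃ i, aLo i ≤ a ∧ a ≤ aHi i ∧ δ ≤ τ i ∧ hLo i ≤ u ∧ u + ω ≤ hHi i) :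
    AtlasCoversPC s Λ c₀ ℓ₀ (fun a L w' => IsRegisteredWordBH δ hLoB hHiB a L w' ∧ a ∈ W)
      fun i => InBoxWH s (aLo i) (aHi i) (τ i) (hLo i) (hHi i) := by
  intro a ha L w' hA hreg
  obtain ⟨u, hu1, hu2, hregu⟩ :=
    isRegisteredWordBH_narrow ha hωB hreg.1 fun n hn m m' => hHO a hreg.2 ha L w' hA hreg.1 n hn m m'
  obtain ⟨i, haLo, haHi, hτ, hlo, hhi⟩ := hcover a (hW hreg.2).1 (hW hreg.2).2 u hu1 hu2
  exact ⟨i, inBoxWH_of_registeredBH ha.le hA hregu haLo haHi hτ hlo hhi⟩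

/-- ★★ **THE WINDOWED R3-W DOOR WITH A TWO-DIMENSIONAL COVER**: ZZZYREC's `uniformEquilStabilityAtIn_of_atlasW_hollow_window` with the cover
clause `hLo i ≤ hLoB ∧ hHiB ≤ hHi i` (cell band ⊇ whole H-band) REPLACED by: height oscillation rigidity (L1′) `HOscPIn … ω W` and a cover of
every `(a, u)`, `a ∈ [amin, amax]`, `[u, u + ω] ⊆ [hLoB, hHiB]`, by a cell whose height box contains `[u, u + ω]` — so cells with NARROW height
boxes (width `≥ ω` plus overlap) are admissible.  All other hypotheses verbatim. [g102] -/
theorem uniformEquilStabilityAtIn_of_atlasW_hollow_window₂ {s Λ c₀ ℓ₀ r₁ ϱ R cZ κ₁ κ₀ γT δ hLoB hHiB amin amax ω : ℝ} {W : Set ℝ}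
    {aLo aHi τ hLo hHi c cK : ι → ℝ} {ΘR ΘN : ι → (E3 ≃L[ℝ] E3) → (ℤ → E3) → (Cell 2 × ℤ) × (Cell 2 × ℤ) → ℝ}
    (h0 : 0 ≤ κ₁) (hκ : κ₀ ≤ κ₁ * cZ - γT) (hRI : UniformReindexPCIn s Λ c₀ ℓ₀ (IsRegisteredWord δ) W)
    (hHB : HBandP s Λ c₀ ℓ₀ hLoB hHiB) (hHol : HollowP s Λ c₀ ℓ₀ δ) (hcK0 : ∀ i, 0 ≤ cK i) (hcK : ∀ i, cK i * c i ≤ 1)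
    (hCS : CellSumP s Λ c₀ ℓ₀ r₁) (hNC : CellNullLagrangianP s Λ c₀ ℓ₀ r₁) (hW : W ⊆ Set.Icc amin amax)
    (hωB : hLoB + ω ≤ hHiB) (hHO : HOscPIn s Λ c₀ ℓ₀ δ hLoB hHiB ω W)
    (hcover : ∀ a : ℝ, amin ≤ a → a ≤ amax → ∀ u : ℝ, hLoB ≤ u → u + ω ≤ hHiB →
      ∃ i, aLo i ≤ a ∧ a ≤ aHi i ∧ δ ≤ τ i ∧ hLo i ≤ u ∧ u + ω ≤ hHi i)
    (hcell : ∀ i, BoxCellCertificateP s Λ c₀ ℓ₀ r₁ (InBoxWH s (aLo i) (aHi i) (τ i) (hLo i) (hHi i)) (c i))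
    (htail : ∀ i, BoxTailDebitP s Λ c₀ ℓ₀ ϱ (InBoxWH s (aLo i) (aHi i) (τ i) (hLo i) (hHi i)) (ΘR i) (ΘN i) γT)
    (hPU : PartitionIdentityFullP s Λ c₀ ℓ₀ r₁ ϱ R) (hPD : PartitionIdentityDebitP s Λ c₀ ℓ₀ ϱ R)
    (hclus : ∀ i, BoxClusterCertificateDebitP s Λ c₀ ℓ₀ r₁ ϱ R (InBoxWH s (aLo i) (aHi i) (τ i) (hLo i) (hHi i)) (cK i) (ΘR i) (ΘN i) κ₁)
    (hCZ : IndexCurrencyP s Λ c₀ ℓ₀ r₁ cZ) : UniformEquilStabilityAtIn s Λ κ₀ c₀ W :=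
  uniformEquilStabilityAtIn_of_atlasC h0 hκ (uniformReindexPCIn_window (uniformReindexPCIn_bandedHollow hRI hHB hHol)) hcK0 hcK hCS hNC
    (atlasCoversPC_of_shapeCoverWH_window₂ hW hωB hHO hcover) hcell htail hPU hPD hclus hCZ

/-- CONSISTENCY: the door of record is the full-width case `ω = hHiB − hLoB` of the two-dimensional door ((L1′) is then the band itself). [g102] -/
theorem hOscPIn_width {s Λ c₀ ℓ₀ δ hLoB hHiB : ℝ} {W : Set ℝ} : HOscPIn s Λ c₀ ℓ₀ δ hLoB hHiB (hHiB - hLoB) W := by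
  intro a _ _ L w' _ _ n hn m m'
  have h1 := hn.2.2.2 (m - 1)
  have h2 := hn.2.2.2 (m' - 1)
  simp only [sub_add_cancel] at h1 h2
  show |⟪w' m - w' (m - 1), n⟫ - ⟪w' m' - w' (m' - 1), n⟫| ≤ (hHiB - hLoB) * a
  rw [abs_sub_le_iff]
  constructor <;> nlinarith [h1.1, h1.2, h2.1, h2.2]

/-! ## §2 The dichotomy split of (L1′): normal stress balance (P1, proved from D1) ∧ own-gap dominance (P2, instrumentable) -/

/-- the increment profile of `w'` with its NORMAL components replaced by the real profile `y` (in-plane registry part — letters and slips — kept):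
the one-parameter-per-gap family along which the normal stress is tested. [g102] -/
def normalProfile (n : E3) (w' : ℤ → E3) (y : ℤ → ℝ) (k : ℤ) : E3 :=
  (w' k - w' (k - 1)) - ⟪w' k - w' (k - 1), n⟫ • n + y k • n

/-- the TRANSMITTED NORMAL STRESS across gap `m` (normal component of the PS column's `gapStress`) as a function of the gap-height profile `y`,
the word's in-plane registry being frozen. [g102] -/
def normalStress (g₁ g₂ n : E3) (w' : ℤ → E3) (m : ℤ) (y : ℤ → ℝ) : ℝ :=
  ⟪gapStress g₁ g₂ m (normalProfile n w' y), n⟫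

/-- at the word's own heights the tested profile IS the word's increment profile. [g102] -/
theorem normalProfile_stepNormal (n : E3) (w' : ℤ → E3) :
    normalProfile n w' (stepNormal n w') = ChartedPlanarOrderProfileSlavingLJ.incr w' := by
  funext k
  simp only [normalProfile, stepNormal, ChartedPlanarOrderProfileSlavingLJ.incr, sub_add_cancel]

/-- **(P1) «WordStressBalancePIn s Λ c₀ ℓ₀ δ hLoB hHiB W» — NORMAL STRESS BALANCE** (the SPECIAL locus, part 1): every admissible banded-hollow
word at a scale in `W` transmits the same normal stress across every gap.  PROVED below from D1 `NashBalance Λ` (for `0 < c₀`, `0 < hLoB`). [g102] -/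
def WordStressBalancePIn (s Λ c₀ ℓ₀ δ hLoB hHiB : ℝ) (W : Set ℝ) : Prop :=
  ∀ a : ℝ, a ∈ W → 0 < a → ∀ (L : E3 ≃L[ℝ] E3) (w' : ℤ → E3), IsAdmissibleWord a s Λ c₀ ℓ₀ L w' →
    IsRegisteredWordBH δ hLoB hHiB a L w' → ∀ n : E3, IsBandNormal hLoB hHiB a L w' n →
      BalancedAt (normalStress (gen₁ L) (gen₂ L) n w') (stepNormal n w')

/-- **(P2) «OwnGapDominancePIn s Λ c₀ ℓ₀ δ hLoB hHiB lam ε η W» — OWN-GAP DOMINANCE** (the SPECIAL locus, part 2; INSTRUMENTABLE · UNDECIDED):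
along every admissible banded-hollow word at a scale in `W`, on profiles valued in the word's OWN heights, the normal stress across a gap is
`lam`-strongly monotone in that gap's height, `ε`-Lipschitz (sup norm) in the other heights, and `η`-insensitive to the registry context under
index shift.  Census reading: `lam` = nearest-layer normal stiffness, `ε` = sum of span-`≥ 2` normal couplings, `η` = letter-flip + slip effect on
the transmitted normal force (slip-dial dependent). [g102] -/
def OwnGapDominancePIn (s Λ c₀ ℓ₀ δ hLoB hHiB lam ε η : ℝ) (W : Set ℝ) : Prop :=
  ∀ a : ℝ, a ∈ W → 0 < a → ∀ (L : E3 ≃L[ℝ] E3) (w' : ℤ → E3), IsAdmissibleWord a s Λ c₀ ℓ₀ L w' →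
    IsRegisteredWordBH δ hLoB hHiB a L w' → ∀ n : E3, IsBandNormal hLoB hHiB a L w' n →
      DominatesAt (normalStress (gen₁ L) (gen₂ L) n w') (stepNormal n w') lam ε η

/-- the chart's in-plane generators have norm `≤ Λ` on an admissible word. [g102] -/
theorem norm_gen_le {a s Λ c₀ ℓ₀ : ℝ} {L : E3 ≃L[ℝ] E3} {w' : ℤ → E3} (hA : IsAdmissibleWord a s Λ c₀ ℓ₀ L w') :
    ‖gen₁ L‖ ≤ Λ ∧ ‖gen₂ L‖ ≤ Λ := by
  have hL := hA.1
  constructor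
  · calc ‖gen₁ L‖ ≤ ‖(L : E3 →L[ℝ] E3)‖ * ‖triangularVec₁ 1‖ := ContinuousLinearMap.le_opNorm _ _
      _ ≤ Λ := by rw [OverbindingBudgetLiouvilleDictionary.norm_triangularVec₁_one, mul_one]; exact hL
  · calc ‖gen₂ L‖ ≤ ‖(L : E3 →L[ℝ] E3)‖ * ‖triangularVec₂ 1‖ := ContinuousLinearMap.le_opNorm _ _
      _ ≤ Λ := by rw [ChartedPlanarOrderDoorLayered.norm_triangularVec₂_one, mul_one]; exact hL

/-- a band normal with a positive band floor height-sorts the word (the PS column's `IsStacked`). [g102] -/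
theorem isStacked_of_isBandNormal {hLoB hHiB a : ℝ} {L : E3 ≃L[ℝ] E3} {w' : ℤ → E3} {n : E3} (hlo : 0 < hLoB) (ha : 0 < a)
    (hn : IsBandNormal hLoB hHiB a L w' n) : IsStacked (gen₁ L) (gen₂ L) w' :=
  ⟨n, by rw [real_inner_comm]; exact hn.2.1, by rw [real_inner_comm]; exact hn.2.2.1,
    fun m => by rw [real_inner_comm]; exact (mul_pos hlo ha).trans_le (hn.2.2.2 m).1⟩

/-- ★ GLUE (P1) ⟸ D1: the tree's `NashBalance Λ` gives normal stress balance along every admissible banded-hollow word. [g102] -/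
theorem wordStressBalancePIn_of_nashBalance {s Λ c₀ ℓ₀ δ hLoB hHiB : ℝ} {W : Set ℝ} (hc₀ : 0 < c₀) (hlo : 0 < hLoB)
    (hNB : NashBalance Λ) : WordStressBalancePIn s Λ c₀ ℓ₀ δ hLoB hHiB W := by
  intro a _ ha L w' hA _ n hn
  obtain ⟨h1, h2⟩ := norm_gen_le hA
  obtain ⟨-, -, -, hco, -, hclean, hnash⟩ := hA
  obtain ⟨σ, hσ⟩ := hNB c₀ hc₀ (gen₁ L) (gen₂ L) w' h1 h2 (isSep_of_isLayeredCrystal hco) hclean hnash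
    (isStacked_of_isBandNormal hlo ha hn)
  refine ⟨⟪σ, n⟫, fun m => ?_⟩
  show ⟪gapStress (gen₁ L) (gen₂ L) m (normalProfile n w' (stepNormal n w')), n⟫ = ⟪σ, n⟫
  rw [normalProfile_stepNormal, hσ m]

/-- ★ (P1) HOLDS (D1 is proved in the tree: `…StraddleSummable.nashBalance_holds`). [g102] -/
theorem wordStressBalancePIn_holds {s Λ c₀ ℓ₀ δ hLoB hHiB : ℝ} {W : Set ℝ} (hc₀ : 0 < c₀) (hlo : 0 < hLoB) :
    WordStressBalancePIn s Λ c₀ ℓ₀ δ hLoB hHiB W :=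
  wordStressBalancePIn_of_nashBalance hc₀ hlo (nashBalance_holds Λ)

/-- ★★ THE DICHOTOMY SPLIT: (L1′) ⟸ (P1) ∧ (P2) ∧ width arithmetic, through the one-profile contraction. [g102] -/
theorem hOscPIn_of_dominance {s Λ c₀ ℓ₀ δ hLoB hHiB lam ε η ω : ℝ} {W : Set ℝ} (hε : 0 ≤ ε) (hlam : ε < lam)
    (hω : ∀ a : ℝ, a ∈ W → 0 < a → η / (lam - ε) ≤ ω * a)
    (hP1 : WordStressBalancePIn s Λ c₀ ℓ₀ δ hLoB hHiB W) (hP2 : OwnGapDominancePIn s Λ c₀ ℓ₀ δ hLoB hHiB lam ε η W) :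
    HOscPIn s Λ c₀ ℓ₀ δ hLoB hHiB ω W := by
  intro a haW ha L w' hA hreg n hn m m'
  have hbd : ∀ k : ℤ, hLoB * a ≤ stepNormal n w' k ∧ stepNormal n w' k ≤ hHiB * a := fun k => by
    have h1 := hn.2.2.2 (k - 1)
    simp only [sub_add_cancel] at h1
    exact h1
  exact (osc_le_of_dominates hbd hε hlam (hP2 a haW ha L w' hA hreg n hn) (hP1 a haW ha L w' hA hreg n hn) m m').trans
    (hω a haW ha)

/-- ★★ (L1′) FROM (P2) ALONE plus arithmetic (P1 discharged by the tree). [g102] -/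
theorem hOscPIn_of_dominance' {s Λ c₀ ℓ₀ δ hLoB hHiB lam ε η ω : ℝ} {W : Set ℝ} (hc₀ : 0 < c₀) (hlo : 0 < hLoB)
    (hε : 0 ≤ ε) (hlam : ε < lam) (hω : ∀ a : ℝ, a ∈ W → 0 < a → η / (lam - ε) ≤ ω * a)
    (hP2 : OwnGapDominancePIn s Λ c₀ ℓ₀ δ hLoB hHiB lam ε η W) : HOscPIn s Λ c₀ ℓ₀ δ hLoB hHiB ω W :=
  hOscPIn_of_dominance hε hlam hω (wordStressBalancePIn_holds hc₀ hlo) hP2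

/-- ★★★ THE ASSEMBLED NODE: the windowed target from the leaves of record, a two-dimensional cell cover of width `ω`, and OWN-GAP DOMINANCE
(P2) with `η / (lam − ε) ≤ ω·amin` — the only new undecided leaf. [g102] -/
theorem uniformEquilStabilityAtIn_of_atlasW_hollow_window₂_of_dominance
    {s Λ c₀ ℓ₀ r₁ ϱ R cZ κ₁ κ₀ γT δ hLoB hHiB amin amax ω lam ε η : ℝ} {W : Set ℝ}
    {aLo aHi τ hLo hHi c cK : ι → ℝ} {ΘR ΘN : ι → (E3 ≃L[ℝ] E3) → (ℤ → E3) → (Cell 2 × ℤ) × (Cell 2 × ℤ) → ℝ}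
    (h0 : 0 ≤ κ₁) (hκ : κ₀ ≤ κ₁ * cZ - γT) (hRI : UniformReindexPCIn s Λ c₀ ℓ₀ (IsRegisteredWord δ) W)
    (hHB : HBandP s Λ c₀ ℓ₀ hLoB hHiB) (hHol : HollowP s Λ c₀ ℓ₀ δ) (hcK0 : ∀ i, 0 ≤ cK i) (hcK : ∀ i, cK i * c i ≤ 1)
    (hCS : CellSumP s Λ c₀ ℓ₀ r₁) (hNC : CellNullLagrangianP s Λ c₀ ℓ₀ r₁) (hW : W ⊆ Set.Icc amin amax)
    (hc₀ : 0 < c₀) (hlo : 0 < hLoB) (hωB : hLoB + ω ≤ hHiB) (hamin : 0 < amin)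
    (hε : 0 ≤ ε) (hlam : ε < lam) (hη : 0 ≤ η) (hωa : η / (lam - ε) ≤ ω * amin)
    (hP2 : OwnGapDominancePIn s Λ c₀ ℓ₀ δ hLoB hHiB lam ε η W)
    (hcover : ∀ a : ℝ, amin ≤ a → a ≤ amax → ∀ u : ℝ, hLoB ≤ u → u + ω ≤ hHiB →
      ∃ i, aLo i ≤ a ∧ a ≤ aHi i ∧ δ ≤ τ i ∧ hLo i ≤ u ∧ u + ω ≤ hHi i)
    (hcell : ∀ i, BoxCellCertificateP s Λ c₀ ℓ₀ r₁ (InBoxWH s (aLo i) (aHi i) (τ i) (hLo i) (hHi i)) (c i))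
    (htail : ∀ i, BoxTailDebitP s Λ c₀ ℓ₀ ϱ (InBoxWH s (aLo i) (aHi i) (τ i) (hLo i) (hHi i)) (ΘR i) (ΘN i) γT)
    (hPU : PartitionIdentityFullP s Λ c₀ ℓ₀ r₁ ϱ R) (hPD : PartitionIdentityDebitP s Λ c₀ ℓ₀ ϱ R)
    (hclus : ∀ i, BoxClusterCertificateDebitP s Λ c₀ ℓ₀ r₁ ϱ R (InBoxWH s (aLo i) (aHi i) (τ i) (hLo i) (hHi i)) (cK i) (ΘR i) (ΘN i) κ₁)
    (hCZ : IndexCurrencyP s Λ c₀ ℓ₀ r₁ cZ) : UniformEquilStabilityAtIn s Λ κ₀ c₀ W := by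
  have hω0 : 0 ≤ ω := by
    have h1 : 0 ≤ η / (lam - ε) := div_nonneg hη (sub_pos.2 hlam).le
    nlinarith [h1.trans hωa]
  have hω : ∀ a : ℝ, a ∈ W → 0 < a → η / (lam - ε) ≤ ω * a := fun a haW _ =>
    hωa.trans (mul_le_mul_of_nonneg_left (hW haW).1 hω0)
  exact uniformEquilStabilityAtIn_of_atlasW_hollow_window₂ h0 hκ hRI hHB hHol hcK0 hcK hCS hNC hW hωB
    (hOscPIn_of_dominance' hc₀ hlo hε hlam hω hP2) hcover hcell htail hPU hPD hclus hCZ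

end Summit.AtomisticToContinuum.Crystallization.Theorems.ChartedZeroExcessLayeredLatticeLiouville

end
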